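import Literature.AlgebraicGeometry.Resolution.HypersurfaceRestrictionTransform
import Literature.AlgebraicGeometry.Resolution.BlowupsProduct
import HarnessLib

/-!
# Controlled and strict transforms commute with base change along which the exceptional divisor stays Cartier

Topic: `Literature/AlgebraicGeometry/Resolution`. The ideal-theoretic half of the SPECIALIZATION
step for multiple blow-ups of marked ideals (spreading out of resolutions,
`SpreadsShapedFromGenericPoint` in `CanonicalResolutionSpread.lean`): along a FLAT base change
the controlled transform `σᶜ(𝓘, μ) = (σ^*𝓘 : 𝓘(D)^μ)` and the strict transforms
`⋃ₙ (σ^*K : 𝓘(D)ⁿ)` commute with pull-back because colon ideals do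
(`comap_controlledTransform_of_flat`, `MarkedIdealsEtale.lean`). Along an ARBITRARY morphism
`s` (e.g. the inclusion of a fibre `X' ×_{Spec D} Spec k → X'`, not flat) colon ideals do not
commute with pull-back in general, but EXACT QUOTIENTS by an effective Cartier divisor do, as
soon as the divisor pulls back to an effective Cartier divisor (which is the case for an
exceptional divisor flat over the base, `IsEffectiveCartier.comap_fst_of_flat_subschemeι`,
`BlowupsRelativeCartier.lean`). Everything is PROVED, for ideal sheaves on arbitrary schemes:

* `colon_pow_eq_of_mul_eq` — if `P` is an effective Cartier divisor and `Pⁿ · K = L` then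
  `(L : Pⁿ) = K` (cancellation of Cartier divisors);
* `comap_colon_pow_of_mul_eq` — **exact quotients commute with pull-back**: if moreover `s^*P`
  is an effective Cartier divisor then `s^*(L : Pⁿ) = (s^*L : (s^*P)ⁿ)`;
* `comap_controlledTransform_of_isEffectiveCartier` — **the controlled transform commutes with
  base change** along a commutative square `s ≫ π = π' ≫ t` whenever `σ^*𝓘 ⊆ 𝓘(D)^μ` (BGMW
  Lemma 3.2.1, e.g. an admissible centre) and the exceptional divisor `D` pulls back along `s`
  to an effective Cartier divisor: `s^* σᶜ(𝓘, μ) = σ'ᶜ(t^*𝓘, μ)`;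
* `iSup_colon_pow_eq_of_mul_eq_of_colon_eq` — if `Pᵐ · K = L` with `K` saturated
  (`(K : P) = K`) then `⋃ₙ (L : Pⁿ) = K`; `comap_iSup_colon_pow_of_mul_eq` — hence
  `s^*(⋃ₙ (L : Pⁿ)) = ⋃ₙ (s^*L : (s^*P)ⁿ)` when `s^*K` is again saturated for `s^*P`;
  `comap_strictTransformIdeal_of_isEffectiveCartier` — **the strict transform of a divisor
  commutes with base change** under these hypotheses;
* `MarkedIdeal.transform_comap_of_isEffectiveCartier` (and the `MarkedIdeal.comap` packaging
  `…'`) — **the transform of a marked ideal commutes with such a base change** (ideal and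
  boundary, BGMW Def. 3.1.3 (3)–(5) in families).

## Sources

* E. Bierstone, D. Grigoriev, P. Milman, J. Włodarczyk, arXiv:1206.3090, §3.2 (transforms),
  Lemma 3.2.1, Def. 3.1.3 (3)–(5). [BierstoneGrigorievMilmanWlodarczyk2011]
* U. Görtz, T. Wedhorn, *Algebraic Geometry I*, 2nd ed. (2020), (13.19) (strict transform as
  schematic closure), Prop. 13.91. [GortzWedhorn2020]
* The Stacks Project, Tag 056P (relative effective Cartier divisors). [StacksProject]
-/

noncomputable section

open CategoryTheory AlgebraicGeometry TopologicalSpace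

namespace Literature.AlgebraicGeometry.Resolution

universe u

/-! ## Exact quotients by an effective Cartier divisor -/

section ExactQuotient

variable {X Y : Scheme.{u}}

/-- Colon by a product: `(K : M · N) = ((K : M) : N)`. [folklore] -/
theorem colon_mul_eq_colon_colon (K M N : X.IdealSheafData) :
    colon K (M * N) = colon (colon K M) N := by
  apply le_antisymm
  · rw [le_colon_iff, le_colon_iff, ← mul_assoc]
    exact mul_colon_le K (M * N)
  · rw [le_colon_iff]
    have h1 : N * colon (colon K M) N ≤ colon K M := mul_colon_le _ _
    have h2 : M * (N * colon (colon K M) N) ≤ K := (le_colon_iff.mp h1)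
    rwa [← mul_assoc] at h2

/-- **Cancellation of an effective Cartier divisor in a colon ideal**: if `P` is an effective
Cartier divisor and `Pⁿ · K = L` then `(L : Pⁿ) = K`. [folklore] -/
theorem colon_pow_eq_of_mul_eq {P K L : X.IdealSheafData} (hP : IsEffectiveCartier P) {n : ℕ}
    (h : P ^ n * K = L) : colon L (P ^ n) = K := by
  refine le_antisymm ((hP.pow n).le_of_mul_le_mul ?_) (le_colon_iff.mpr h.le)
  rw [h]
  exact mul_colon_le L (P ^ n)

/-- **Exact quotients by a Cartier divisor commute with pull-back**: if `P` is an effective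
Cartier divisor on `X` with `Pⁿ · K = L`, and `s : Y → X` is any morphism along which `P` pulls
back to an effective Cartier divisor, then `s^*(L : Pⁿ) = (s^*L : (s^*P)ⁿ)`. [folklore] -/
theorem comap_colon_pow_of_mul_eq (s : Y ⟶ X) {P K L : X.IdealSheafData}
    (hP : IsEffectiveCartier P) (hPs : IsEffectiveCartier (P.comap s)) {n : ℕ}
    (h : P ^ n * K = L) :
    (colon L (P ^ n)).comap s = colon (L.comap s) (P.comap s ^ n) := by
  rw [colon_pow_eq_of_mul_eq hP h, colon_pow_eq_of_mul_eq hPs]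
  rw [← comap_pow, ← comap_mul, h]

/-- A saturated ideal stays saturated for all powers: `(K : P) = K` implies `(K : Pʲ) = K`.
[folklore] -/
theorem colon_pow_eq_self_of_colon_eq {K P : X.IdealSheafData} (hK : colon K P = K) (j : ℕ) :
    colon K (P ^ j) = K := by
  induction j with
  | zero => rw [pow_zero, Scheme.IdealSheafData.one_eq_top, colon_top]
  | succ j ih => rw [pow_succ, colon_mul_eq_colon_colon, ih, hK]

/-- **The saturation of an exact multiple of a saturated ideal**: if `P` is an effective
Cartier divisor, `Pᵐ · K = L` and `K` is `P`-saturated (`(K : P) = K`), then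
`⋃ₙ (L : Pⁿ) = K`. [folklore] -/
theorem iSup_colon_pow_eq_of_mul_eq_of_colon_eq {P K L : X.IdealSheafData}
    (hP : IsEffectiveCartier P) {m : ℕ} (h : P ^ m * K = L) (hK : colon K P = K) :
    ⨆ n : ℕ, colon L (P ^ n) = K := by
  apply le_antisymm
  · refine iSup_le fun n => ?_
    rcases le_or_gt n m with hnm | hmn
    · -- `(Pᵐ K : Pⁿ) = P^{m-n} K ⊆ K`
      obtain ⟨j, rfl⟩ := Nat.exists_eq_add_of_le hnm
      have hj : P ^ n * (P ^ j * K) = L := by rw [← mul_assoc, ← pow_add, h]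
      rw [colon_pow_eq_of_mul_eq hP hj]
      exact mul_le_of_le_one_left bot_le le_top
    · -- `(Pᵐ K : P^{m+j}) = (K : Pʲ) = K`
      obtain ⟨j, rfl⟩ := Nat.exists_eq_add_of_le hmn.le
      rw [pow_add, colon_mul_eq_colon_colon, colon_pow_eq_of_mul_eq hP h,
        colon_pow_eq_self_of_colon_eq hK]
  · calc K = colon L (P ^ m) := (colon_pow_eq_of_mul_eq hP h).symm
      _ ≤ ⨆ n : ℕ, colon L (P ^ n) := le_iSup (fun n : ℕ => colon L (P ^ n)) m

/-- **Saturations of exact multiples commute with pull-back**: with `P`, `K`, `L` as in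
`iSup_colon_pow_eq_of_mul_eq_of_colon_eq`, if along `s : Y → X` the divisor `P` pulls back to
an effective Cartier divisor and `s^*K` is `s^*P`-saturated, then
`s^*(⋃ₙ (L : Pⁿ)) = ⋃ₙ (s^*L : (s^*P)ⁿ)` (both equal `s^*K`). [folklore] -/
theorem comap_iSup_colon_pow_of_mul_eq (s : Y ⟶ X) {P K L : X.IdealSheafData}
    (hP : IsEffectiveCartier P) (hPs : IsEffectiveCartier (P.comap s)) {m : ℕ}
    (h : P ^ m * K = L) (hK : colon K P = K) (hKs : colon (K.comap s) (P.comap s) = K.comap s) :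
    (⨆ n : ℕ, colon L (P ^ n)).comap s = ⨆ n : ℕ, colon (L.comap s) (P.comap s ^ n) := by
  have h' : P.comap s ^ m * K.comap s = L.comap s := by rw [← comap_pow, ← comap_mul, h]
  rw [iSup_colon_pow_eq_of_mul_eq_of_colon_eq hP h hK,
    iSup_colon_pow_eq_of_mul_eq_of_colon_eq hPs h' hKs]

end ExactQuotient

/-! ## Controlled and strict transforms under base change -/

section Transforms

open Scheme.IdealSheafData

variable {Y' Y Z' Z : Scheme.{u}} (t : Y' ⟶ Y) {π : Z ⟶ Y} {π' : Z' ⟶ Y'} {s : Z' ⟶ Z}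

/-- **The controlled transform commutes with base change along which the exceptional divisor
stays Cartier** (BGMW §3.2 / Def. 3.1.3 (3) in families): let `s ≫ π = π' ≫ t` be a commutative
square (e.g. the cartesian square of a blow-up `π` of `Y` along `C` and its base change `π'`,
`BlowupSequencesBaseChange.lean`), suppose the exceptional ideal `𝓘(D) = π^*C` is an effective
Cartier divisor with `π^*𝓘 ⊆ 𝓘(D)^μ` (BGMW Lemma 3.2.1: `C` an admissible centre of `(𝓘, μ)`)
and that `s^*𝓘(D)` is still an effective Cartier divisor (e.g. `D` flat over the base,
`IsEffectiveCartier.comap_fst_of_flat_subschemeι`). Then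
`s^* σᶜ(𝓘, μ) = (π'^* t^*𝓘 : 𝓘(D')^μ)`, `D' = s⁻¹D = π'⁻¹ V(t^*C)`: the controlled transform of
the pulled-back marked ideal is the pull-back of the controlled transform.
[cite: BierstoneGrigorievMilmanWlodarczyk2011, §3.2 with Lemma 3.2.1 and Def. 3.1.3 (3)] -/
theorem comap_controlledTransform_of_isEffectiveCartier [IsLocallyNoetherian Z]
    (hsq : s ≫ π = π' ≫ t) (C I : Y.IdealSheafData) (μ : ℕ)
    (hD : IsEffectiveCartier (C.comap π)) (hle : I.comap π ≤ C.comap π ^ μ)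
    (hDs : IsEffectiveCartier ((C.comap π).comap s)) :
    (controlledTransform π C I μ).comap s = controlledTransform π' (C.comap t) (I.comap t) μ := by
  have h := pow_mul_controlledTransform_eq π C hD hle
  rw [controlledTransform, controlledTransform, comap_colon_pow_of_mul_eq s hD hDs h,
    ← comap_comp, ← comap_comp, hsq, comap_comp, comap_comp]

/-- **The strict transform of a divisor commutes with base change** under exact division and
saturation: for the same square, if `π^*K = 𝓘(D)ᵐ · K'` with `K'` saturated (`(K' : 𝓘(D)) = K'`,
so that `K'` is the strict transform `⋃ₙ (π^*K : 𝓘(D)ⁿ)`), `s^*𝓘(D)` is an effective Cartier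
divisor and `s^*K'` is `s^*𝓘(D)`-saturated, then
`s^*(⋃ₙ (π^*K : 𝓘(D)ⁿ)) = ⋃ₙ (π'^* t^*K : 𝓘(D')ⁿ)` — the strict transform of the pulled-back
divisor is the pull-back of the strict transform (BGMW Def. 3.1.3 (4) in families; for a
boundary divisor having simple normal crossings with the centre, `m ∈ {0, 1}` locally and the
saturation hypotheses say that `D` restricted to the strict transform stays a Cartier divisor
in the fibre). [cite: BierstoneGrigorievMilmanWlodarczyk2011, Def. 3.1.3 (4); GortzWedhorn2020, (13.19)] -/
theorem comap_strictTransformIdeal_of_isEffectiveCartier (hsq : s ≫ π = π' ≫ t)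
    (C K : Y.IdealSheafData) {K' : Z.IdealSheafData} {m : ℕ}
    (hD : IsEffectiveCartier (C.comap π)) (h : C.comap π ^ m * K' = K.comap π)
    (hK' : colon K' (C.comap π) = K') (hDs : IsEffectiveCartier ((C.comap π).comap s))
    (hK's : colon (K'.comap s) ((C.comap π).comap s) = K'.comap s) :
    (strictTransformIdeal π C K).comap s = strictTransformIdeal π' (C.comap t) (K.comap t) := by
  rw [strictTransformIdeal, strictTransformIdeal, comap_iSup_colon_pow_of_mul_eq s hD hDs h hK' hK's,
    ← comap_comp, ← comap_comp, hsq, comap_comp, comap_comp]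

/-- **The transform of a marked ideal commutes with base change along which the exceptional
divisor stays Cartier** (BGMW Def. 3.1.3 (3)–(5) in families; the non-flat analogue of
`MarkedIdeal.transform_comap_of_flat`): for the square `s ≫ π = π' ≫ t`, if `𝓘(D) = π^*C` is
an effective Cartier divisor with `π^*𝓘 ⊆ 𝓘(D)^μ`, `s^*𝓘(D)` is an effective Cartier divisor,
and every boundary divisor `K` of `M` pulls back to an exact multiple `π^*K = 𝓘(D)^m · K'` of
a saturated `K'` whose pull-back `s^*K'` is again saturated, then the transform of
`t^*M = (t^*𝓘, t^*E, μ)` under `π'` with centre `t^*C` is the pull-back along `s` of the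
transform of `M` under `π` (ideal: `comap_controlledTransform_of_isEffectiveCartier`; boundary:
`comap_strictTransformIdeal_of_isEffectiveCartier` in order, then the exceptional divisor
`s⁻¹ D = π'⁻¹ V(t^*C)`).
[cite: BierstoneGrigorievMilmanWlodarczyk2011, Def. 3.1.3 (3)–(5)] -/
theorem MarkedIdeal.transform_comap_of_isEffectiveCartier [IsLocallyNoetherian Z]
    (hsq : s ≫ π = π' ≫ t) (M : MarkedIdeal Y) (C : Y.IdealSheafData)
    (hD : IsEffectiveCartier (C.comap π)) (hle : M.ideal.comap π ≤ C.comap π ^ M.mult)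
    (hDs : IsEffectiveCartier ((C.comap π).comap s))
    (hE : ∀ K ∈ M.boundary, ∃ (m : ℕ) (K' : Z.IdealSheafData),
      C.comap π ^ m * K' = K.comap π ∧ colon K' (C.comap π) = K' ∧
        colon (K'.comap s) ((C.comap π).comap s) = K'.comap s) :
    (⟨M.ideal.comap t, M.boundary.map (·.comap t), M.mult⟩ : MarkedIdeal Y').transform π'
        (C.comap t) =
      ⟨(M.transform π C).ideal.comap s, (M.transform π C).boundary.map (·.comap s), M.mult⟩ := by
  simp only [MarkedIdeal.transform, List.map_append, List.map_map, List.map_cons, List.map_nil,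
    comap_controlledTransform_of_isEffectiveCartier t hsq C M.ideal M.mult hD hle hDs]
  congr 2
  · refine List.map_congr_left fun K hK => ?_
    obtain ⟨m, K', h, hK', hK's⟩ := hE K hK
    simp only [Function.comp_apply,
      comap_strictTransformIdeal_of_isEffectiveCartier t hsq C K hD h hK' hDs hK's]
  · rw [← Scheme.IdealSheafData.comap_comp, ← Scheme.IdealSheafData.comap_comp, hsq]

/-- The same in the packaging `MarkedIdeal.comap`: `(t^*M).transform π' (t^*C) = s^*(M.transform π C)`.
[cite: BierstoneGrigorievMilmanWlodarczyk2011, Def. 3.1.3 (3)–(5)] -/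
theorem MarkedIdeal.transform_comap_of_isEffectiveCartier' [IsLocallyNoetherian Z]
    (hsq : s ≫ π = π' ≫ t) (M : MarkedIdeal Y) (C : Y.IdealSheafData)
    (hD : IsEffectiveCartier (C.comap π)) (hle : M.ideal.comap π ≤ C.comap π ^ M.mult)
    (hDs : IsEffectiveCartier ((C.comap π).comap s))
    (hE : ∀ K ∈ M.boundary, ∃ (m : ℕ) (K' : Z.IdealSheafData),
      C.comap π ^ m * K' = K.comap π ∧ colon K' (C.comap π) = K' ∧
        colon (K'.comap s) ((C.comap π).comap s) = K'.comap s) :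
    (M.comap t).transform π' (C.comap t) = (M.transform π C).comap s :=
  MarkedIdeal.transform_comap_of_isEffectiveCartier t hsq M C hD hle hDs hE

end Transforms

end Literature.AlgebraicGeometry.Resolution

end
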